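import Summits.HubbardSuperconductivity.HubbardSuperconductivity.Theorems.CooperPairDMottWalkPlaquetteModel
import Literature.MathematicalPhysics.QuantumLattice.TwoSpeciesSectorArrays
import HarnessLib

/-!
# Crux `DressHalfFilled` (stmt-HubbardSuperconductivity-8148, route `LevyLogBootstrap`; shared with route
# `AnisotropyChord`): pushing a sector trial vector through the plaquette relabelling, coordinatewise —
# registered (W1)-certificate stub `dressHalfFilled_w1_pushOfSectorArrayEqVecMul`

Support file (`--supports stmt-HubbardSuperconductivity-8148`) for STUB 1 `stub_plaquetteData`, clause (W1) (the
Kato-kernel window at `U = 2`). The certificate legs evaluate vectors `Γ (ofSectorArray sa sb w)` — a two-species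
sector trial vector of the `Fin 4` plaquette model with coordinate array `w` (`TwoSpecies.ofSectorArray`), pushed to
the plaquette by the signed permutation unitary `Γ = gam` (`…CooperPairDMottWalkPlaquetteModel`). Since
`w ↦ ofSectorArray sa sb w` and `Γ *ᵥ ·` are linear, the pushed vector is the `w`-combination of the pushed
ELEMENTARY arrays `δ_I` (`I : Fin p × Fin q`), i.e. a `vecMul` of the flattened array against the table of pushed
elementary vectors — which is how the kernel evaluates it:

* `mulVec_ofSectorArray_eq_vecMul` — for ANY matrix `G`,
  `G (ofSectorArray sa sb w) = (I ↦ w_I) ᵥ* (I, s ↦ (G ofSectorArray sa sb δ_I) s)`;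
* `dressHalfFilled_w1_pushOfSectorArrayEqVecMul` — the registered stub (the case `G = Γ`), verbatim.

Elementary linear algebra (E. H. Lieb, PRL 62 (1989) 1201, proof of Thm 1, for the coordinates); no definition
and no named fact is introduced; sorry-free. REUSED: `TwoSpecies.ofSectorArray_sum/_smul`.
-/

noncomputable section

set_option linter.dupNamespace false

namespace Summit.HubbardSuperconductivity.HubbardSuperconductivity.Theorems.LevyLogBootstrap

open Matrix Finset Literature.MathematicalPhysics.QuantumLattice
open Literature.MathematicalPhysics.QuantumLattice.TwoSpecies
open Summit.HubbardSuperconductivity.HubbardSuperconductivity.Theorems.CooperPairDMottWalk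
open scoped ComplexOrder

/-- An array is the combination of the elementary arrays `δ_I` with its own entries. [folklore] -/
theorem sectorArray_eq_sum_elementary {p q : ℕ} (w : Fin p → Fin q → ℂ) :
    w = ∑ I : Fin p × Fin q, w I.1 I.2 • fun i j => if i = I.1 ∧ j = I.2 then (1 : ℂ) else 0 := by
  funext i j
  simp only [Finset.sum_apply, Pi.smul_apply, smul_eq_mul, mul_ite, mul_one, mul_zero]
  rw [Fintype.sum_prod_type]
  simp only [Finset.sum_ite, Finset.sum_const_zero, add_zero]
  rw [Finset.sum_eq_single i]
  · rw [Finset.sum_filter]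
    simp
  · intro i' _ hi'
    rw [Finset.filter_eq_empty_iff.mpr fun j' _ h => hi' h.1.symm, Finset.sum_empty]
  · intro h; exact absurd (Finset.mem_univ i) h

/-- **Pushing a sector trial vector through a linear map, coordinatewise**: for any matrix `G` and any array
`w`, `G (ofSectorArray sa sb w) = (I ↦ w_I) ᵥ* (I, s ↦ (G ofSectorArray sa sb δ_I) s)` (linearity of
`ofSectorArray` and of `G *ᵥ ·`). [folklore] -/
theorem mulVec_ofSectorArray_eq_vecMul {Λ : Type*} [LinearOrder Λ] [Fintype Λ] {κ : Type*}
    (G : Matrix κ (Finset (Orb Λ)) ℂ) {p q : ℕ}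
    (sa : Fin p → Finset Λ) (sb : Fin q → Finset Λ) (w : Fin p → Fin q → ℂ) :
    G *ᵥ ofSectorArray sa sb w = (fun I : Fin p × Fin q => w I.1 I.2) ᵥ*
      (Matrix.of fun (I : Fin p × Fin q) (s : κ) =>
        (G *ᵥ ofSectorArray sa sb (fun i j => if i = I.1 ∧ j = I.2 then (1 : ℂ) else 0)) s) := by
  conv_lhs => rw [sectorArray_eq_sum_elementary w]
  rw [ofSectorArray_sum]
  simp only [ofSectorArray_smul, Matrix.mulVec_sum, Matrix.mulVec_smul]
  funext s
  simp only [Finset.sum_apply, Pi.smul_apply, smul_eq_mul, Matrix.vecMul, dotProduct, Matrix.of_apply]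

/-- Registered stub `dressHalfFilled_w1_pushOfSectorArrayEqVecMul` (item stmt-HubbardSuperconductivity-8148, (W1)
certificate chain): the pushed trial vector `Γ (ofSectorArray sa sb w)` of the plaquette is the `vecMul` of the
flattened array against the pushed elementary arrays (`mulVec_ofSectorArray_eq_vecMul` with `G = Γ`). [folklore] -/
theorem dressHalfFilled_w1_pushOfSectorArrayEqVecMul : ∀ {p q : ℕ} {sa : Fin p → Finset (Fin 4)} {sb : Fin q → Finset (Fin 4)} (w : Fin p → Fin q → ℂ), gam *ᵥ ofSectorArray sa sb w = (fun I : Fin p × Fin q => w I.1 I.2) ᵥ* (Matrix.of fun (I : Fin p × Fin q) (s : Finset (Orb PlaquetteSite)) => (gam *ᵥ ofSectorArray sa sb (fun i j => if i = I.1 ∧ j = I.2 then (1 : ℂ) else 0)) s) :=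
  fun w => mulVec_ofSectorArray_eq_vecMul gam _ _ w

end Summit.HubbardSuperconductivity.HubbardSuperconductivity.Theorems.LevyLogBootstrap

end
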